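import Summits.QuantumFields.YangMills.Theses.OnsetSkewLaw
import Literature.MathematicalPhysics.QuantumLattice.GaugeGroupsProofs

/-!
# `SkewVarianceLaw` (route OnsetSkewLaw, item stmt-QuantumFields-23136) is false modulo `PolynomialSeed`

Negative lemmas for the refuter pass on route `route-QuantumFields-OnsetSkewLaw` (rev 2).

* `q3State_eq_zero_of_skewVarianceLaw` — the **zero-atom instance** of K1: `SkewVarianceLaw` is stated for EVERY
  compactly supported Schwartz bump `b`, in particular `b = 0`, where every atom weight vanishes, `rpSq ≡ 0` and the
  running record `amp ≡ 0`; the near-record and smallness hypotheses then hold trivially and the error budget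
  `C·(amp² √amp + s²·amp √amp)` is `0`, so K1 forces `Q3State G r μ s f g h = 0` for ALL smearings `f g h`, all
  `s ∈ (0,1]`, all odd-torus limit states `μ` at all `β ≥ β₀(f,g,h)`: K1 as typed asserts that the smeared plaquette
  skewness of every SU(2)-class lattice Yang–Mills theory vanishes identically at large `β`.
* `skewVarianceLaw_false_of_skewnessNonvanishing` — hence K1 is false modulo the bare non-Gaussianity hypothesis
  `SU2OddTorusSkewnessNonvanishing` (`H`, defined here), and `skewVarianceLaw_false_of_polynomialSeed` — K1 contradicts the route's own non-degeneracy crux K2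
  (`PolynomialSeed`, item stmt-QuantumFields-23160), which produces, for `G = SU(2)`, the fundamental `r` and a
  positive-time bump `b` with `∫ b ≠ 0`, smearings `f g h` with `0 = 0·(…) < |Q3State G r μ s f g h|` at some
  `β ≥ β₀`, `μ ∈ oddTorusLimitPoints r β`, `s ∈ (0,1]` (take `C := 0` in K2).  So `PolynomialSeed → ¬ SkewVarianceLaw`:
  the cone `{K1, K2}` is inconsistent and the glue `SkewFloorsGlue` / `Assembly` close ex falso.

Classification (refuter): `SkewVarianceLaw` is MISSTATED — the zero / integral-free atom is plainly unintended (K2 and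
K3 carry `tsupport b ⊆ {0 < u 0}` and `∫ b ≠ 0`; the route header speaks of "a nice bump b").  Minimal repair C′:
add `tsupport b ⊆ {u | 0 < u 0} → (∫ u, b u) ≠ 0 →` after `HasCompactSupport b →` in K1 (the witness `b = 0` then
misses C′); a more robust repair also guards the law by `0 < amp s` (or an additive `s`-power floor in the error
budget), since ANY admissible scale with `amp s = 0` again forces exact vanishing of `Q3State` at that scale.
No unconditional `¬ SkewVarianceLaw` is landed: that would require a kernel proof that some odd-torus limit state of
4D SU(2) lattice Yang–Mills has a non-vanishing smeared third plaquette cumulant at arbitrarily large `β`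
(non-Gaussianity — open), which is exactly hypothesis `PolynomialSeed`. [folklore]
-/

namespace Summit.QuantumFields.YangMills.Theorems.SkewVarianceLaw.Negative

open MeasureTheory Metric
open Literature.MathematicalPhysics.QuantumFieldTheory Literature.MathematicalPhysics.QuantumLattice
open Summit.QuantumFields.YangMills.Theorems.InfiniteVolume Summit.QuantumFields.YangMills.Theorems.InfVolRP
open Summit.QuantumFields.YangMills.Theses.OnsetSkewLaw

/-- **Hypothesis `H` of the negative lemma — odd-torus skewness non-vanishing for `SU(2)`.**  For some faithful
unitary lattice representation `r` of `SU(2)` and some real Schwartz smearings `f g h`, at arbitrarily large `β`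
there is an odd-torus thermodynamic-limit state `μ ∈ oddTorusLimitPoints r β` of 4D lattice Yang–Mills and a
resolution `s ∈ (0,1]` at which the smeared third plaquette cumulant `Q3State SU(2) r μ s f g h` is non-zero.  This
is the bare non-Gaussianity content of the route's crux `PolynomialSeed` (which implies it:
`skewnessNonvanishing_of_polynomialSeed`); no construction of such a state with a certified non-zero third cumulant
at large `β` exists in the tree (it would need a convergent large-`β` expansion for connected plaquette correlations),
so it is recorded as the hypothesis of `skewVarianceLaw_false_of_skewnessNonvanishing`.
[topic: lattice Yang–Mills, odd-torus limit states, non-Gaussianity of plaquette cumulants] -/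
def SU2OddTorusSkewnessNonvanishing : Prop :=
  letI : MeasurableSpace (Matrix.specialUnitaryGroup (Fin 2) ℂ) := borel _
  haveI : BorelSpace (Matrix.specialUnitaryGroup (Fin 2) ℂ) := ⟨rfl⟩
  ∃ (r : LatticeRep (Matrix.specialUnitaryGroup (Fin 2) ℂ)) (f g h : SchwartzMap (EuclideanSpace ℝ (Fin 4)) ℝ),
    ∀ β₀ : ℝ, ∃ β : ℝ, β₀ ≤ β ∧ ∃ μ ∈ oddTorusLimitPoints r β, ∃ s : ℝ, 0 < s ∧ s ≤ 1 ∧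
      Q3State (Matrix.specialUnitaryGroup (Fin 2) ℂ) r μ s f g h ≠ 0

/-- **Zero-atom instance of K1.** `SkewVarianceLaw` (applied with the bump `b = 0`, for which `amp ≡ 0`) forces the
smeared skewness `Q3State G r μ s f g h` to vanish for every `f g h`, every `s ∈ (0,1]` and every odd-torus limit
state `μ` at all sufficiently large `β`. [folklore] -/
theorem q3State_eq_zero_of_skewVarianceLaw (hK1 : SkewVarianceLaw)
    (G : Type) [Group G] [TopologicalSpace G] [IsTopologicalGroup G] [CompactSpace G]
    (hG : IsCompactSimpleLieGroup G) (hE : Nonempty (G ≃ₜ* Matrix.specialUnitaryGroup (Fin 2) ℂ))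
    (r : LatticeRep G) (f g h : SchwartzMap (EuclideanSpace ℝ (Fin 4)) ℝ) :
    letI : MeasurableSpace G := borel G
    haveI : BorelSpace G := ⟨rfl⟩
    ∃ β₀ : ℝ, ∀ β : ℝ, β₀ ≤ β → ∀ μ ∈ oddTorusLimitPoints r β,
      ∀ s : ℝ, 0 < s → s ≤ 1 → Q3State G r μ s f g h = 0 := by
  letI : MeasurableSpace G := borel G
  haveI : BorelSpace G := ⟨rfl⟩
  have hcs : HasCompactSupport (⇑(0 : SchwartzMap (EuclideanSpace ℝ (Fin 4)) ℝ)) := by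
    rw [FunLike.coe_zero]; exact HasCompactSupport.zero
  obtain ⟨κ, hκ⟩ := hK1 G hG hE r 0 f g h hcs
  obtain ⟨C, δ₀, β₀, -, hδ₀, hmain⟩ := hκ 1 le_rfl
  refine ⟨β₀, fun β hβ μ hμ s hs hs1 => ?_⟩
  have key := hmain β hβ μ hμ
  simp only [zero_apply, ite_self, zero_mul, tsum_zero, Real.iSup_const_zero] at key
  have h2 := key s hs hs1 (fun s' _ _ => by simp) hδ₀.le
  simpa using h2

/-- **K1 is false modulo `H`.** `SU2OddTorusSkewnessNonvanishing → ¬ SkewVarianceLaw`, by the zero-atom instance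
`q3State_eq_zero_of_skewVarianceLaw` at `G = SU(2)`. [folklore] -/
theorem skewVarianceLaw_false_of_skewnessNonvanishing (hH : SU2OddTorusSkewnessNonvanishing) :
    ¬ SkewVarianceLaw := by
  intro hK1
  obtain ⟨r, f, g, h, hH⟩ := hH
  have hG : IsCompactSimpleLieGroup (Matrix.specialUnitaryGroup (Fin 2) ℂ) :=
    isCompactSimpleLieGroup_specialUnitaryGroup isSimpleCompactGroup_specialUnitaryGroup_holds le_rfl
  obtain ⟨β₀, hzero⟩ := q3State_eq_zero_of_skewVarianceLaw hK1 _ hG ⟨ContinuousMulEquiv.refl _⟩ r f g h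
  obtain ⟨β, hβ, μ, hμ, s, hs, hs1, hne⟩ := hH β₀
  exact hne (hzero β hβ μ hμ s hs hs1)

/-- **K2 implies `H`.** `PolynomialSeed` instantiated at `G = SU(2)`, the fundamental representation and a smooth
bump centred at `(1,1,1,1)` with outer radius `1/2` (compact support inside `{u | 0 < u 0}`, positive integral),
with `C := 0` in its conclusion, yields smearings whose `Q3State` is non-zero at arbitrarily large `β`. [folklore] -/
theorem skewnessNonvanishing_of_polynomialSeed (hK2 : PolynomialSeed) : SU2OddTorusSkewnessNonvanishing := by
  have hG : IsCompactSimpleLieGroup (Matrix.specialUnitaryGroup (Fin 2) ℂ) :=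
    isCompactSimpleLieGroup_specialUnitaryGroup isSimpleCompactGroup_specialUnitaryGroup_holds le_rfl
  have hE : Nonempty (Matrix.specialUnitaryGroup (Fin 2) ℂ ≃ₜ* Matrix.specialUnitaryGroup (Fin 2) ℂ) :=
    ⟨ContinuousMulEquiv.refl _⟩
  let r : LatticeRep (Matrix.specialUnitaryGroup (Fin 2) ℂ) :=
    ⟨2, fundamentalRep (Fin 2), continuous_fundamentalRep _, fundamentalRep_injective _,
      fundamentalRep_mem_unitaryGroup⟩
  -- a positive-time bump with non-zero integral
  let c : EuclideanSpace ℝ (Fin 4) := WithLp.toLp 2 fun _ => (1 : ℝ)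
  let φ : ContDiffBump c := ⟨1 / 4, 1 / 2, by norm_num, by norm_num⟩
  let b : SchwartzMap (EuclideanSpace ℝ (Fin 4)) ℝ := φ.hasCompactSupport.toSchwartzMap φ.contDiff
  have hb_cs : HasCompactSupport (⇑b) := φ.hasCompactSupport
  have hb_supp : tsupport (⇑b) ⊆ {u : EuclideanSpace ℝ (Fin 4) | 0 < u 0} := by
    intro u hu
    have hu' : u ∈ closedBall c φ.rOut := by
      rw [← φ.tsupport_eq]; exact hu
    rw [mem_closedBall, dist_eq_norm] at hu'
    have h0 : |u 0 - 1| ≤ 1 / 2 := by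
      have := PiLp.norm_apply_le (u - c) 0
      rw [PiLp.sub_apply, Real.norm_eq_abs] at this
      exact this.trans hu'
    show 0 < u 0
    rcases abs_le.mp h0 with ⟨h1, -⟩
    linarith
  have hb_int : (∫ u, b u) ≠ 0 := (φ.integral_pos (μ := volume)).ne'
  obtain ⟨f, g, h, t₁, t₂, M, -, -, -, -, hseed⟩ := hK2 _ hG hE r b hb_cs hb_supp hb_int
  refine ⟨r, f, g, h, fun β₀ => ?_⟩
  obtain ⟨β, hβ, μ, hμ, hrest⟩ := hseed 0 1 β₀ one_pos
  simp only [zero_mul] at hrest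
  obtain ⟨s, hs, hs1, -, -, hlt⟩ := hrest
  exact ⟨β, hβ, μ, hμ, s, hs, hs1, fun h0 => by rw [h0, abs_zero] at hlt; exact lt_irrefl _ hlt⟩

/-- **K1 is false modulo K2**: the cone `{SkewVarianceLaw, PolynomialSeed}` of route OnsetSkewLaw is inconsistent
(so its glue `SkewFloorsGlue` and `Assembly` close ex falso). [folklore] -/
theorem skewVarianceLaw_false_of_polynomialSeed (hK2 : PolynomialSeed) : ¬ SkewVarianceLaw :=
  skewVarianceLaw_false_of_skewnessNonvanishing (skewnessNonvanishing_of_polynomialSeed hK2)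

end Summit.QuantumFields.YangMills.Theorems.SkewVarianceLaw.Negative
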